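import Summits.AtomisticToContinuum.HydrodynamicLimit.Theorems.EnskogAdjointDualityAdjointEnskogTestFamilyROperatorKappaZeroPrep
import Summits.AtomisticToContinuum.HydrodynamicLimit.Theorems.EnskogAdjointDualityAdjointEnskogTestFamilyRKernelBridge
import HarnessLib

/-!
# K2R refutation, stub `operatorKappaOne` — preparation: the dipole dual gain kernel on `S² × ℝ³`

Route `EnskogAdjointDuality` of `AtomisticToContinuum/HydrodynamicLimit`, crux K2R
`AdjointEnskogTestFamilyR` (stmt-AtomisticToContinuum-11592), line `refutation`, registered stub
`stub_operatorKappaOne` (identity (I) for the corrector part `κ` of the test function, tested against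
`ζ(s) sin(2πx₀) Θ₁^R(v)` with the dipole weight `Θ₁^R(v) = |v|(1+|v|²)⁻⁴e^{-|v|²/R} v₀`).

Measure-theoretic plumbing around the explicit dual gain kernels of the landed stub `stub_dualitySlice`,
`I₀^R(U, n) = ½ e^{-(|U|²-⟪U,n⟫²)/2} h(⟪U,n⟫) Θ̄₀^R(⟪U,n⟫²)` and
`I₁^R(U, n) = n₀ ⟪U,n⟫ · ½ e^{-(|U|²-⟪U,n⟫²)/2} h(⟪U,n⟫) Θ̄₁^R(⟪U,n⟫²)` (passed, as in the companion file
`…ROperatorKappaZeroPrep`, as variables `I₀, I₁` with defining equations `hI₀, hI₁`; the dipole weight is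
the variable `Θ₁`, equation `hΘ₁`):

* `k2r_ref_ok1_abs_mul_T1_le` — the tail comparison `|a| Θ̄₁^R(a²) ≤ Θ̄₀^R(a²)` (`|a|√E ≤ E ≤ 1 + E` on
  `E ≥ a²`; registered keyed sub-goal `stub_operatorKappaOne_prep`), hence `|I₁^R| ≤ I₀^R` pointwise
  (`k2r_ref_ok1_abs_I1_le`);
* `k2r_ref_ok1_continuous_I1` — joint continuity of the dipole kernel in `(U, n)`;
* `k2r_ref_ok1_triple_gen` — the exchange behind the gain terms for a general weight `Θ` with
  `(1+|v|²)²Θ ∈ L¹` and a kernel `I` satisfying the per-direction duality of `stub_dualitySlice`: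
  for a continuous `K(ω, U)` of quadratic growth,
  `∫ Θ(v) ∫∫_{S²×ℝ³} ((v-w)·ω)₊ M(w) K(ω, w') = ∫_{S²} ∫ K(ω, U) I(U, ω) dU dσ`
  with the integrability of both slice functions (domination by `(1+|v|)³|Θ(v)| ⊗ (1+|w|)³M(w)`,
  Fubini in `(v, ω)`, then the duality direction by direction); specialised to `Θ₁^R / I₁^R`
  (`k2r_ref_ok1_triple1`);
* `k2r_ref_ok1_dominated1` — `(ω, U) ↦ F(U) I₁^R(U, ω)` is integrable on `σ ⊗ dU` for measurable `F` of
  quadratic growth (domination by the master function `(1+|U|²) I₀^R` of `k2r_ref_ok0_integrable_SV`).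

References: C. Cercignani, R. Illner, M. Pulvirenti, *The Mathematical Theory of Dilute Gases* (1994),
§3.1 (1.7)–(1.9) [CIP1994].
-/

noncomputable section

open MeasureTheory Set Filter Function
open scoped InnerProductSpace Real

namespace Summit.AtomisticToContinuum.HydrodynamicLimit.Theorems.EnskogAdjointDuality

open Literature.MathematicalPhysics.KineticTheory Literature.Analysis.FluidPDE Literature.Analysis.FunctionSpaces

/-! ## One-dimensional facts and the tail comparison -/

/-- Integrability of the two radial weights on `(0, ∞)`, continuity of their tails on `[0, ∞)`,
continuity and nonnegativity of the half-Gaussian moment `h`. [folklore] -/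
theorem k2r_ref_ok1_one_dim {R : ℝ} (hR : 0 < R) :
    IntegrableOn (fun E : ℝ => ((1 + E) ^ 3)⁻¹ * Real.exp (-E / R)) (Ioi 0) ∧
    IntegrableOn (fun E : ℝ => Real.sqrt E * ((1 + E) ^ 4)⁻¹ * Real.exp (-E / R)) (Ioi 0) ∧
    ContinuousOn (fun x : ℝ => ∫ E in Ioi x, ((1 + E) ^ 3)⁻¹ * Real.exp (-E / R)) (Ici 0) ∧
    ContinuousOn (fun x : ℝ => ∫ E in Ioi x, Real.sqrt E * ((1 + E) ^ 4)⁻¹ * Real.exp (-E / R))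
      (Ici 0) ∧
    Continuous (fun a : ℝ => ∫ b, max (a - b) 0 * (Real.exp (-b ^ 2 / 2) / Real.sqrt (2 * π))) ∧
    (∀ a : ℝ, 0 ≤ ∫ b, max (a - b) 0 * (Real.exp (-b ^ 2 / 2) / Real.sqrt (2 * π))) := by
  have h0 : IntegrableOn (fun E : ℝ => ((1 + E) ^ 3)⁻¹ * Real.exp (-E / R)) (Ioi 0) :=
    (k2r_ref_integrableOn_moment hR (Nat.zero_le 3)).congr_fun
      (fun E _ => by simp only [pow_zero, one_mul]) measurableSet_Ioi
  have h1 := k2r_ref_kb_integrableOn_th1 hR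
  exact ⟨h0, h1, h0.continuousOn_Ici_primitive_Ioi, h1.continuousOn_Ici_primitive_Ioi,
    stub_halfGaussian.1.1, fun a => (k2r_ref_h_bounds a).1⟩

/-- **The tail comparison** `|a| Θ̄₁^R(a²) ≤ Θ̄₀^R(a²)`: on `E ≥ a²`, `|a|√E ≤ E ≤ 1 + E`, so
`|a| √E (1+E)⁻⁴ ≤ (1+E)⁻³`. [folklore] -/
theorem k2r_ref_ok1_abs_mul_T1_le {R : ℝ} (hR : 0 < R) (a : ℝ) :
    |a| * (∫ E in Ioi (a ^ 2), Real.sqrt E * ((1 + E) ^ 4)⁻¹ * Real.exp (-E / R)) ≤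
      ∫ E in Ioi (a ^ 2), ((1 + E) ^ 3)⁻¹ * Real.exp (-E / R) := by
  obtain ⟨h0, h1, -⟩ := k2r_ref_ok1_one_dim hR
  have hs : Ioi (a ^ 2) ⊆ Ioi (0 : ℝ) := Ioi_subset_Ioi (sq_nonneg a)
  rw [← integral_const_mul]
  refine setIntegral_mono_on ((h1.mono_set hs).const_mul _) (h0.mono_set hs) measurableSet_Ioi
    fun E hE => ?_
  have hE' : a ^ 2 < E := hE
  have hE0 : 0 ≤ E := (sq_nonneg a).trans hE'.le
  have ha : |a| ≤ Real.sqrt E := by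
    rw [← Real.sqrt_sq_eq_abs]
    exact Real.sqrt_le_sqrt hE'.le
  have hE1 : (0 : ℝ) < 1 + E := by linarith
  calc |a| * (Real.sqrt E * ((1 + E) ^ 4)⁻¹ * Real.exp (-E / R))
      ≤ Real.sqrt E * (Real.sqrt E * ((1 + E) ^ 4)⁻¹ * Real.exp (-E / R)) := by gcongr
    _ = E * ((1 + E) ^ 4)⁻¹ * Real.exp (-E / R) := by
        rw [← mul_assoc, ← mul_assoc, Real.mul_self_sqrt hE0]
    _ ≤ (1 + E) * ((1 + E) ^ 4)⁻¹ * Real.exp (-E / R) := by gcongr; linarith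
    _ = ((1 + E) ^ 3)⁻¹ * Real.exp (-E / R) := by field_simp

/-- **Registered keyed sub-goal `stub_operatorKappaOne_prep`** of stub `operatorKappaOne` (line
`refutation` of crux K2R `AdjointEnskogTestFamilyR`): the tail comparison
`|a| Θ̄₁^R(a²) ≤ Θ̄₀^R(a²)` behind `|I₁^R| ≤ I₀^R`. [folklore] -/
theorem stub_operatorKappaOne_prep : ∀ (R a : ℝ), 0 < R → |a| * (∫ E in Set.Ioi (a ^ 2), Real.sqrt E * ((1 + E) ^ 4)⁻¹ * Real.exp (-E / R)) ≤ ∫ E in Set.Ioi (a ^ 2), ((1 + E) ^ 3)⁻¹ * Real.exp (-E / R) :=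
  fun _ a hR => k2r_ref_ok1_abs_mul_T1_le hR a

/-! ## The two kernels -/

variable {Θ₀ Θ₁ : ℝ → V3 → ℝ} {I₀ I₁ : ℝ → V3 → V3 → ℝ}
variable (hΘ₀ : ∀ R v, Θ₀ R v = ((1 + ‖v‖ ^ 2) ^ 3)⁻¹ * Real.exp (-‖v‖ ^ 2 / R))
  (hΘ₁ : ∀ R v, Θ₁ R v = Real.sqrt (‖v‖ ^ 2) * ((1 + ‖v‖ ^ 2) ^ 4)⁻¹ * Real.exp (-‖v‖ ^ 2 / R) * v 0)
  (hI₀ : ∀ R U n, I₀ R U n = (1 / 2 : ℝ) * Real.exp (-(‖U‖ ^ 2 - ⟪U, n⟫_ℝ ^ 2) / 2) *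
    (∫ b, max (⟪U, n⟫_ℝ - b) 0 * (Real.exp (-b ^ 2 / 2) / Real.sqrt (2 * π))) *
    ∫ E in Ioi (⟪U, n⟫_ℝ ^ 2), ((1 + E) ^ 3)⁻¹ * Real.exp (-E / R))
  (hI₁ : ∀ R U n, I₁ R U n = n 0 * ⟪U, n⟫_ℝ * ((1 / 2 : ℝ) * Real.exp (-(‖U‖ ^ 2 - ⟪U, n⟫_ℝ ^ 2) / 2) *
    (∫ b, max (⟪U, n⟫_ℝ - b) 0 * (Real.exp (-b ^ 2 / 2) / Real.sqrt (2 * π))) *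
    ∫ E in Ioi (⟪U, n⟫_ℝ ^ 2), Real.sqrt E * ((1 + E) ^ 4)⁻¹ * Real.exp (-E / R)))
include hΘ₀ hΘ₁ hI₀ hI₁

omit hΘ₀ hΘ₁ in
/-- **The kernel comparison**: `0 ≤ I₀^R(U, n)` and `|I₁^R(U, n)| ≤ I₀^R(U, n)` whenever `|n₀| ≤ 1`
(`h ≥ 0`, `Θ̄₁ ≥ 0`, and the tail comparison). [folklore] -/
theorem k2r_ref_ok1_abs_I1_le {R : ℝ} (hR : 0 < R) (U n : V3) (hn : |n 0| ≤ 1) :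
    0 ≤ I₀ R U n ∧ |I₁ R U n| ≤ I₀ R U n := by
  set a : ℝ := ⟪U, n⟫_ℝ with ha
  set hh : ℝ := ∫ b, max (a - b) 0 * (Real.exp (-b ^ 2 / 2) / Real.sqrt (2 * π)) with hhh
  set T0 : ℝ := ∫ E in Ioi (a ^ 2), ((1 + E) ^ 3)⁻¹ * Real.exp (-E / R) with hT0d
  set T1 : ℝ := ∫ E in Ioi (a ^ 2), Real.sqrt E * ((1 + E) ^ 4)⁻¹ * Real.exp (-E / R) with hT1d
  have hh0 : 0 ≤ hh := (k2r_ref_ok1_one_dim hR).2.2.2.2.2 a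
  have hT1 : 0 ≤ T1 :=
    (k2r_ref_tail_bounds (θ := fun E => Real.sqrt E * ((1 + E) ^ 4)⁻¹ * Real.exp (-E / R))
      (fun E hE => k2r_ref_th1_bounds hR hE) (sq_nonneg a)).1
  have hcmp : |a| * T1 ≤ T0 := k2r_ref_ok1_abs_mul_T1_le hR a
  have hT0 : 0 ≤ T0 := le_trans (by positivity) hcmp
  set X : ℝ := (1 / 2 : ℝ) * Real.exp (-(‖U‖ ^ 2 - a ^ 2) / 2) with hX
  have hX0 : 0 ≤ X := by positivity
  have e0 : I₀ R U n = X * hh * T0 := hI₀ R U n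
  have e1 : I₁ R U n = n 0 * a * (X * hh * T1) := hI₁ R U n
  have hP : 0 ≤ X * hh * T1 := by positivity
  refine ⟨by rw [e0]; positivity, ?_⟩
  rw [e1, e0, abs_mul, abs_mul, abs_of_nonneg hP]
  calc |n 0| * |a| * (X * hh * T1) = |n 0| * (X * hh * (|a| * T1)) := by ring
    _ ≤ 1 * (X * hh * T0) := by gcongr
    _ = _ := one_mul _

omit hΘ₀ hΘ₁ hI₀ in
/-- Joint continuity of the dipole kernel `(U, n) ↦ I₁^R(U, n)` (`h` is continuous by
`stub_halfGaussian`, the tail `Θ̄₁^R` is continuous on `[0, ∞)`), and continuity of its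
`S² × ℝ³` version `(ω, U) ↦ I₁^R(U, ω)`. [folklore] -/
theorem k2r_ref_ok1_continuous_I1 {R : ℝ} (hR : 0 < R) :
    Continuous (fun p : V3 × V3 => I₁ R p.1 p.2) ∧
    Continuous (fun q : Metric.sphere (0 : V3) 1 × V3 => I₁ R q.2 q.1) := by
  obtain ⟨-, -, -, hT1, hh, -⟩ := k2r_ref_ok1_one_dim hR
  have hin : Continuous fun p : V3 × V3 => ⟪p.1, p.2⟫_ℝ := continuous_fst.inner continuous_snd
  have hc1 : Continuous fun p : V3 × V3 =>
      ∫ E in Ioi (⟪p.1, p.2⟫_ℝ ^ 2), Real.sqrt E * ((1 + E) ^ 4)⁻¹ * Real.exp (-E / R) :=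
    hT1.comp_continuous (hin.pow 2) fun p => mem_Ici.2 (sq_nonneg _)
  have hE : Continuous fun p : V3 × V3 =>
      (1 / 2 : ℝ) * Real.exp (-(‖p.1‖ ^ 2 - ⟪p.1, p.2⟫_ℝ ^ 2) / 2) := by fun_prop
  have hX : Continuous fun p : V3 × V3 =>
      (1 / 2 : ℝ) * Real.exp (-(‖p.1‖ ^ 2 - ⟪p.1, p.2⟫_ℝ ^ 2) / 2) *
        ∫ b, max (⟪p.1, p.2⟫_ℝ - b) 0 * (Real.exp (-b ^ 2 / 2) / Real.sqrt (2 * π)) :=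
    hE.mul (hh.comp hin)
  have hn0 : Continuous fun p : V3 × V3 => p.2 0 :=
    (EuclideanSpace.proj (0 : Fin 3)).continuous.comp continuous_snd
  have hI : Continuous (fun p : V3 × V3 => I₁ R p.1 p.2) := by
    simp only [hI₁]
    exact (hn0.mul hin).mul (hX.mul hc1)
  have h2 : Continuous ((fun p : V3 × V3 => I₁ R p.1 p.2) ∘
      fun q : Metric.sphere (0 : V3) 1 × V3 => (q.2, (q.1 : V3))) :=
    hI.comp (continuous_snd.prodMk (continuous_subtype_val.comp continuous_fst))
  exact ⟨hI, h2⟩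

omit hΘ₀ hI₀ in
/-- `stub_dualitySlice` for the dipole weight: integrability of `F I₁` and the swap formula
`∫ Θ₁ ∫ ((v-w)·ν)₊ M F(w') = ∫ F I₁`. [cite: CIP1994, §3.1 (1.7)–(1.9)] -/
theorem k2r_ref_ok1_dual1 {R : ℝ} (hR : 1 ≤ R) (ν : Metric.sphere (0 : V3) 1) {F : V3 → ℝ}
    (hF : Measurable F) {CF : ℝ} (hCF : ∀ U, |F U| ≤ CF * (1 + ‖U‖ ^ 2)) :
    Integrable (fun U : V3 => F U * I₁ R U ν) ∧
    (∫ v : V3, Θ₁ R v * ∫ w : V3, max ⟪v - w, (ν : V3)⟫_ℝ 0 * globalMaxwellian w *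
        F (w + ⟪v - w, (ν : V3)⟫_ℝ • (ν : V3))) = ∫ U : V3, F U * I₁ R U ν := by
  have h := stub_dualitySlice R hR ν F hF CF hCF
  simp only [hΘ₁, hI₁]
  exact ⟨h.2.2.2.2.1, h.2.2.2.2.2.1⟩

omit hΘ₀ hI₀ hI₁ in
/-- The dipole weight: measurable and `(1+|v|²)²Θ₁^R ∈ L¹`. [folklore] -/
theorem k2r_ref_ok1_w1_facts {R : ℝ} (hR : 0 < R) :
    Measurable (fun v : V3 => Θ₁ R v) ∧ Integrable (fun v : V3 => (1 + ‖v‖ ^ 2) ^ 2 * Θ₁ R v) := by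
  simp only [hΘ₁]
  exact k2r_ref_weight1 hR


/-! ## The exchange behind the gain terms -/

omit hΘ₀ hΘ₁ hI₀ hI₁ in
/-- **The exchange behind the gain terms (generic weight).** Let `Θ` be a measurable velocity weight
with `(1+|v|²)²Θ ∈ L¹`, `I(U, n)` a kernel satisfying the per-direction duality
`∫ Θ(v) ∫ ((v-w)·ν)₊ M(w) F(w') dw dv = ∫ F(U) I(U, ν) dU` for measurable `F` of quadratic growth,
and `K(ω, U)` continuous with `|K(ω, U)| ≤ C_K (1+|U|²)`.  Then the slice functions
`v ↦ Θ(v) ∫∫_{S²×ℝ³} ((v-w)·ω)₊ M(w) K(ω, w')` and `ω ↦ ∫ K(ω, U) I(U, ω) dU` are integrable and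
`∫ Θ(v) ∫∫ ((v-w)·ω)₊ M(w) K(ω, w') d(σ ⊗ dw) dv = ∫_{S²} ∫ K(ω, U) I(U, ω) dU dσ(ω)`
(domination of `(v, ω) ↦ Θ(v) ∫ ((v-w)·ω)₊ M K(ω, w') dw` by `C_K c₃ (1+|v|)³|Θ(v)|`,
`c₃ = ∫ (1+|w|)³ M`, Fubini in `(v, ω)`, then the duality direction by direction).
[cite: CIP1994, §3.1 (1.7)–(1.9)] -/
theorem k2r_ref_ok1_triple_gen {Θ : V3 → ℝ} (hΘm : Measurable Θ)
    (hΘi : Integrable fun v : V3 => (1 + ‖v‖ ^ 2) ^ 2 * Θ v)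
    {I : V3 → V3 → ℝ}
    (hdual : ∀ (ν : Metric.sphere (0 : V3) 1) (F : V3 → ℝ), Measurable F → ∀ CF : ℝ,
      (∀ U, |F U| ≤ CF * (1 + ‖U‖ ^ 2)) →
      Integrable (fun U : V3 => F U * I U ν) ∧
      (∫ v : V3, Θ v * ∫ w : V3, max ⟪v - w, (ν : V3)⟫_ℝ 0 * globalMaxwellian w *
        F (w + ⟪v - w, (ν : V3)⟫_ℝ • (ν : V3))) = ∫ U : V3, F U * I U ν)
    {K : Metric.sphere (0 : V3) 1 × V3 → ℝ} (hK : Continuous K) {CK : ℝ} (hCK : 0 ≤ CK)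
    (hKb : ∀ p, |K p| ≤ CK * (1 + ‖p.2‖ ^ 2)) :
    Integrable (fun v : V3 => Θ v * ∫ p : Metric.sphere (0 : V3) 1 × V3,
        max ⟪v - p.2, (p.1 : V3)⟫_ℝ 0 * globalMaxwellian p.2 *
          K (p.1, p.2 + ⟪v - p.2, (p.1 : V3)⟫_ℝ • (p.1 : V3))
        ∂((sphereMeasure : Measure (Metric.sphere (0 : V3) 1)).prod volume)) ∧
    Integrable (fun ω : Metric.sphere (0 : V3) 1 => ∫ U : V3, K (ω, U) * I U ω)
      (sphereMeasure : Measure (Metric.sphere (0 : V3) 1)) ∧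
    (∫ v : V3, Θ v * ∫ p : Metric.sphere (0 : V3) 1 × V3,
        max ⟪v - p.2, (p.1 : V3)⟫_ℝ 0 * globalMaxwellian p.2 *
          K (p.1, p.2 + ⟪v - p.2, (p.1 : V3)⟫_ℝ • (p.1 : V3))
        ∂((sphereMeasure : Measure (Metric.sphere (0 : V3) 1)).prod volume)) =
      ∫ ω : Metric.sphere (0 : V3) 1, (∫ U : V3, K (ω, U) * I U ω)
        ∂(sphereMeasure : Measure (Metric.sphere (0 : V3) 1)) := by
  haveI := isFiniteMeasure_sphereMeasure (E := V3)
  -- the slice function `H(v, ω) = Θ(v) ∫ ((v-w)·ω)₊ M(w) K(ω, w') dw`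
  set H : V3 × Metric.sphere (0 : V3) 1 → ℝ := fun q => Θ q.1 * ∫ w : V3,
      max ⟪q.1 - w, (q.2 : V3)⟫_ℝ 0 * globalMaxwellian w *
        K (q.2, w + ⟪q.1 - w, (q.2 : V3)⟫_ℝ • (q.2 : V3)) with hH
  -- energy bound for the argument of `K`
  have hKv : ∀ (v : V3) (p : Metric.sphere (0 : V3) 1 × V3),
      |K (p.1, p.2 + ⟪v - p.2, (p.1 : V3)⟫_ℝ • (p.1 : V3))| ≤ CK * (1 + ‖v‖ ^ 2 + ‖p.2‖ ^ 2) := by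
    intro v p
    refine (hKb _).trans (mul_le_mul_of_nonneg_left ?_ hCK)
    have h := (k2r_ref_ko_norm_sq_out_le v p.2 p.1).2
    dsimp only
    linarith
  -- per-`v` product integrability of the gain piece
  have hpiece : ∀ v : V3, Integrable (fun p : Metric.sphere (0 : V3) 1 × V3 =>
      max ⟪v - p.2, (p.1 : V3)⟫_ℝ 0 * globalMaxwellian p.2 *
        K (p.1, p.2 + ⟪v - p.2, (p.1 : V3)⟫_ℝ • (p.1 : V3)))
      ((sphereMeasure : Measure (Metric.sphere (0 : V3) 1)).prod volume) := fun v =>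
    k2r_ref_ko_integrable_piece
      (G := fun p => K (p.1, p.2 + ⟪v - p.2, (p.1 : V3)⟫_ℝ • (p.1 : V3))) (by fun_prop) hCK v (hKv v)
  -- the Gaussian moment `c₃ = ∫ (1+|w|)³ M`
  have hG : Integrable (fun w : V3 => (1 + ‖w‖) ^ 3 * globalMaxwellian w) :=
    Literature.Analysis.UnboundedOperators.integrable_one_add_norm_pow_mul_globalMaxwellian 3
  set c₃ : ℝ := ∫ w : V3, (1 + ‖w‖) ^ 3 * globalMaxwellian w with hc₃
  -- pointwise bound on `H`
  have hHb : ∀ q : V3 × Metric.sphere (0 : V3) 1,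
      ‖H q‖ ≤ CK * c₃ * ((1 + ‖q.1‖) ^ 3 * |Θ q.1|) * 1 := by
    intro q
    have hin : ‖∫ w : V3, max ⟪q.1 - w, (q.2 : V3)⟫_ℝ 0 * globalMaxwellian w *
        K (q.2, w + ⟪q.1 - w, (q.2 : V3)⟫_ℝ • (q.2 : V3))‖ ≤
        ∫ w : V3, CK * (1 + ‖q.1‖) ^ 3 * ((1 + ‖w‖) ^ 3 * globalMaxwellian w) :=
      norm_integral_le_of_norm_le (hG.const_mul _) (Eventually.of_forall fun w => by
        rw [Real.norm_eq_abs]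
        exact k2r_ref_ko_piece_abs_le q.1 w q.2 hCK (hKv q.1 (q.2, w)))
    rw [integral_const_mul] at hin
    rw [hH, norm_mul, Real.norm_eq_abs, mul_one]
    calc |Θ q.1| * ‖∫ w : V3, max ⟪q.1 - w, (q.2 : V3)⟫_ℝ 0 * globalMaxwellian w *
          K (q.2, w + ⟪q.1 - w, (q.2 : V3)⟫_ℝ • (q.2 : V3))‖
        ≤ |Θ q.1| * (CK * (1 + ‖q.1‖) ^ 3 * c₃) := by gcongr
      _ = _ := by ring
  -- measurability of `H`
  have hHm : AEStronglyMeasurable H ((volume : Measure V3).prod sphereMeasure) := by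
    have hM := continuous_globalMaxwellian (E := V3)
    have hc : Continuous fun r : (V3 × Metric.sphere (0 : V3) 1) × V3 =>
        max ⟪r.1.1 - r.2, (r.1.2 : V3)⟫_ℝ 0 * globalMaxwellian r.2 *
          K (r.1.2, r.2 + ⟪r.1.1 - r.2, (r.1.2 : V3)⟫_ℝ • (r.1.2 : V3)) := by fun_prop
    have h1 : StronglyMeasurable fun q : V3 × Metric.sphere (0 : V3) 1 => ∫ w : V3,
        max ⟪q.1 - w, (q.2 : V3)⟫_ℝ 0 * globalMaxwellian w *
          K (q.2, w + ⟪q.1 - w, (q.2 : V3)⟫_ℝ • (q.2 : V3)) :=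
      hc.stronglyMeasurable.integral_prod_right'
    exact ((hΘm.comp measurable_fst).aestronglyMeasurable.mul h1.aestronglyMeasurable)
  -- integrability of `H` on `dv ⊗ σ`
  have hdom : Integrable (fun v : V3 => CK * c₃ * ((1 + ‖v‖) ^ 3 * |Θ v|)) := by
    refine ((hΘi.norm.const_mul (CK * c₃ * 4)).mono' ?_ (Eventually.of_forall fun v => ?_))
    · exact (Measurable.aestronglyMeasurable (by fun_prop))
    · have hc0 : 0 ≤ c₃ := integral_nonneg fun w => by
        have := (globalMaxwellian_pos w).le
        positivity
      rw [Real.norm_of_nonneg (by positivity), norm_mul, Real.norm_of_nonneg (by positivity),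
        Real.norm_eq_abs]
      have h3 := k2r_ref_ok0_cube_le (norm_nonneg v)
      calc CK * c₃ * ((1 + ‖v‖) ^ 3 * |Θ v|) ≤ CK * c₃ * (4 * (1 + ‖v‖ ^ 2) ^ 2 * |Θ v|) := by
            gcongr
        _ = CK * c₃ * 4 * ((1 + ‖v‖ ^ 2) ^ 2 * |Θ v|) := by ring
  have hHi : Integrable H ((volume : Measure V3).prod sphereMeasure) :=
    (hdom.mul_prod (integrable_const (1 : ℝ))).mono' hHm (Eventually.of_forall hHb)
  -- slices in `v`
  have hslice : ∀ v : V3, Θ v * (∫ p : Metric.sphere (0 : V3) 1 × V3,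
      max ⟪v - p.2, (p.1 : V3)⟫_ℝ 0 * globalMaxwellian p.2 *
        K (p.1, p.2 + ⟪v - p.2, (p.1 : V3)⟫_ℝ • (p.1 : V3))
      ∂((sphereMeasure : Measure (Metric.sphere (0 : V3) 1)).prod volume)) =
      ∫ ω : Metric.sphere (0 : V3) 1, H (v, ω) ∂sphereMeasure := fun v => by
    rw [integral_prod _ (hpiece v), ← integral_const_mul]
  -- slices in `ω`: the duality direction by direction
  have hd : ∀ ω : Metric.sphere (0 : V3) 1, Integrable (fun U : V3 => K (ω, U) * I U ω) ∧
      (∫ v : V3, H (v, ω)) = ∫ U : V3, K (ω, U) * I U ω := fun ω =>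
    hdual ω (fun U => K (ω, U)) (hK.measurable.comp (by fun_prop)) CK fun U => hKb (ω, U)
  refine ⟨(hHi.integral_prod_left).congr (Eventually.of_forall fun v => (hslice v).symm),
    (hHi.integral_prod_right).congr (Eventually.of_forall fun ω => (hd ω).2), ?_⟩
  calc (∫ v : V3, Θ v * ∫ p : Metric.sphere (0 : V3) 1 × V3,
        max ⟪v - p.2, (p.1 : V3)⟫_ℝ 0 * globalMaxwellian p.2 *
          K (p.1, p.2 + ⟪v - p.2, (p.1 : V3)⟫_ℝ • (p.1 : V3))
        ∂((sphereMeasure : Measure (Metric.sphere (0 : V3) 1)).prod volume))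
      = ∫ v : V3, ∫ ω : Metric.sphere (0 : V3) 1, H (v, ω) ∂sphereMeasure :=
        integral_congr_ae (Eventually.of_forall hslice)
    _ = ∫ ω : Metric.sphere (0 : V3) 1, (∫ v : V3, H (v, ω)) ∂sphereMeasure :=
        integral_integral_swap hHi
    _ = _ := integral_congr_ae (Eventually.of_forall fun ω => (hd ω).2)

omit hΘ₀ hI₀ in
/-- **The exchange for the dipole weight `Θ₁^R` and kernel `I₁^R`.** [cite: CIP1994, §3.1 (1.7)–(1.9)] -/
theorem k2r_ref_ok1_triple1 {R : ℝ} (hR : 1 ≤ R)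
    {K : Metric.sphere (0 : V3) 1 × V3 → ℝ} (hK : Continuous K) {CK : ℝ} (hCK : 0 ≤ CK)
    (hKb : ∀ p, |K p| ≤ CK * (1 + ‖p.2‖ ^ 2)) :
    Integrable (fun v : V3 => Θ₁ R v * ∫ p : Metric.sphere (0 : V3) 1 × V3,
        max ⟪v - p.2, (p.1 : V3)⟫_ℝ 0 * globalMaxwellian p.2 *
          K (p.1, p.2 + ⟪v - p.2, (p.1 : V3)⟫_ℝ • (p.1 : V3))
        ∂((sphereMeasure : Measure (Metric.sphere (0 : V3) 1)).prod volume)) ∧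
    Integrable (fun ω : Metric.sphere (0 : V3) 1 => ∫ U : V3, K (ω, U) * I₁ R U ω)
      (sphereMeasure : Measure (Metric.sphere (0 : V3) 1)) ∧
    (∫ v : V3, Θ₁ R v * ∫ p : Metric.sphere (0 : V3) 1 × V3,
        max ⟪v - p.2, (p.1 : V3)⟫_ℝ 0 * globalMaxwellian p.2 *
          K (p.1, p.2 + ⟪v - p.2, (p.1 : V3)⟫_ℝ • (p.1 : V3))
        ∂((sphereMeasure : Measure (Metric.sphere (0 : V3) 1)).prod volume)) =
      ∫ ω : Metric.sphere (0 : V3) 1, (∫ U : V3, K (ω, U) * I₁ R U ω)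
        ∂(sphereMeasure : Measure (Metric.sphere (0 : V3) 1)) := by
  obtain ⟨hm, hi⟩ := k2r_ref_ok1_w1_facts hΘ₁ (by linarith : 0 < R)
  exact k2r_ref_ok1_triple_gen (Θ := Θ₁ R) hm hi (I := I₁ R)
    (fun ν _ hF _ hCF => k2r_ref_ok1_dual1 hΘ₁ hI₁ hR ν hF hCF) hK hCK hKb

/-! ## Domination on `S² × ℝ³` by the master function -/

omit hΘ₁ in
/-- **Integrability of `(ω, U) ↦ F(U) I₁^R(U, ω)` on `σ ⊗ dU`** for measurable `F` with
`|F(U)| ≤ C_F (1+|U|²)`: `|F I₁| ≤ C_F (1+|U|²) I₀`, and the master function `(1+|U|²) I₀^R(U, ω)` is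
integrable (`k2r_ref_ok0_integrable_SV`); then Fubini: `∫_{S²} ∫ F I₁ dU dσ = ∫ F(U) ∫_{S²} I₁ dσ dU`
with the `U`-marginal integrable. [folklore] -/
theorem k2r_ref_ok1_dominated1 {R : ℝ} (hR : 1 ≤ R) {F : V3 → ℝ} (hF : Measurable F) {CF : ℝ}
    (hCF : ∀ U, |F U| ≤ CF * (1 + ‖U‖ ^ 2)) :
    Integrable (fun q : Metric.sphere (0 : V3) 1 × V3 => F q.2 * I₁ R q.2 q.1)
      ((sphereMeasure : Measure (Metric.sphere (0 : V3) 1)).prod volume) ∧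
    Integrable (fun U : V3 => F U * ∫ ω : Metric.sphere (0 : V3) 1, I₁ R U ω ∂sphereMeasure) ∧
    ∫ ω : Metric.sphere (0 : V3) 1, (∫ U : V3, F U * I₁ R U ω) ∂sphereMeasure =
      ∫ U : V3, F U * ∫ ω : Metric.sphere (0 : V3) 1, I₁ R U ω ∂sphereMeasure := by
  haveI := isFiniteMeasure_sphereMeasure (E := V3)
  have hR0 : 0 < R := by linarith
  have hCF0 : 0 ≤ CF := by
    have h := hCF 0
    rw [norm_zero] at h
    nlinarith [abs_nonneg (F 0)]
  have hω : ∀ ω : Metric.sphere (0 : V3) 1, |(ω : V3) 0| ≤ 1 := fun ω => by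
    have h := PiLp.norm_apply_le (ω : V3) 0
    rwa [Real.norm_eq_abs, norm_eq_of_mem_sphere ω] at h
  have hM := k2r_ref_ok0_integrable_SV hΘ₀ hI₀ hR
  have hIc := (k2r_ref_ok1_continuous_I1 hI₁ hR0).2
  set G : Metric.sphere (0 : V3) 1 × V3 → ℝ := fun q => F q.2 * I₁ R q.2 q.1 with hG
  have hGm : AEStronglyMeasurable G ((sphereMeasure : Measure (Metric.sphere (0 : V3) 1)).prod volume) :=
    ((hF.comp measurable_snd).aestronglyMeasurable.mul hIc.aestronglyMeasurable)
  have hGi : Integrable G ((sphereMeasure : Measure (Metric.sphere (0 : V3) 1)).prod volume) := by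
    refine (hM.const_mul CF).mono' hGm (Eventually.of_forall fun q => ?_)
    obtain ⟨h0, h1⟩ := k2r_ref_ok1_abs_I1_le hI₀ hI₁ hR0 q.2 (q.1 : V3) (hω q.1)
    rw [Real.norm_eq_abs, hG]
    dsimp only
    rw [abs_mul]
    calc |F q.2| * |I₁ R q.2 q.1| ≤ CF * (1 + ‖q.2‖ ^ 2) * I₀ R q.2 q.1 :=
          mul_le_mul (hCF q.2) h1 (abs_nonneg _) (by positivity)
      _ = CF * ((1 + ‖q.2‖ ^ 2) * I₀ R q.2 q.1) := by ring
  have hpull : ∀ U : V3, ∫ ω : Metric.sphere (0 : V3) 1, G (ω, U) ∂sphereMeasure =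
      F U * ∫ ω : Metric.sphere (0 : V3) 1, I₁ R U ω ∂sphereMeasure := fun U => by
    rw [← integral_const_mul]
  refine ⟨hGi, hGi.integral_prod_right.congr (Eventually.of_forall hpull), ?_⟩
  calc ∫ ω : Metric.sphere (0 : V3) 1, (∫ U : V3, F U * I₁ R U ω) ∂sphereMeasure
      = ∫ q, G q ∂((sphereMeasure : Measure (Metric.sphere (0 : V3) 1)).prod volume) :=
        (integral_prod G hGi).symm
    _ = ∫ U : V3, ∫ ω : Metric.sphere (0 : V3) 1, G (ω, U) ∂sphereMeasure := integral_prod_symm G hGi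
    _ = _ := integral_congr_ae (Eventually.of_forall hpull)

end Summit.AtomisticToContinuum.HydrodynamicLimit.Theorems.EnskogAdjointDuality
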